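import Mathlib
import HarnessLib

/-!
# `HeteroclinicTriggerChain` — BC5 rung for crux `TriggerChainFrontStep` (item stmt-NavierStokesRegularity-22785):
  COMPLETE TRANSFER of the three-mode pump-depletion arc

**Statement.** For `e > 0` and real functions `x u y` with `x′ = −e u²`, `u′ = e x u − e u y`, `y′ = e u²`
everywhere, `x 0 + y 0 = 1`, `x 0² + u 0² + y 0² = 1`, `u 0 > 0`: `y → 1`, `x → 0`, `u → 0` as `t → +∞`.

PROOF. `x + y` and `x² + u² + y²` have zero derivative, hence are constant (`is_const_of_deriv_eq_zero`);
so `x = 1 − y`, `u² = 2y(1−y)` and `y′ = 2e·y(1−y)` (logistic law) with `0 < y 0 < 1`. `y` is monotone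
(`monotone_of_deriv_nonneg`) and bounded by `1`; if `y ≤ 1 − ε` for all time then `y′ ≥ 2e·y(0)·ε > 0` on
`[0, ∞)` and the mean-value inequality (`Convex.mul_sub_le_image_sub_of_le_deriv`) pushes `y` above `1` —
contradiction; so `y → 1` (order characterisation of `Tendsto`), then `x = 1 − y → 0` and `|u| = √(2y(1−y)) → 0`.

HONEST FRAMING: an elementary fact about a three-dimensional quadratic ODE (the exact heteroclinic arc of the
route's trigger-chain table on two shells, rates `e = g`); the witness-of-weakness (BC5, D-0033 T3) for the
route's deciding crux — efficiency-one shell-to-shell transfer at scale ratio 2. Nothing here is a statement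
about the Navier–Stokes equations; no summit and no rung is proved by this file.
-/

noncomputable section

set_option linter.dupNamespace false

open Filter Topology

namespace Summit.NavierStokesRegularity.NavierStokesRegularity.Theorems

/-- **BC5 rung for item stmt-NavierStokesRegularity-22785** (`HeteroclinicTriggerChain.TriggerChainFrontStep`):
complete transfer along the pump-depletion arc `x′ = −eu²`, `u′ = exu − euy`, `y′ = eu²` on the invariant
circle `x + y = 1`, `x² + u² + y² = 1`, `u(0) > 0`: `(x,u,y) → (0,0,1)`. Equals the registered birth stub
`stub_rung_complete_transfer` of the crux skeleton verbatim. [this file] -/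
theorem heteroclinicTriggerChain_transferArc_complete : ∀ e : ℝ, 0 < e → ∀ x u y : ℝ → ℝ,
    (∀ t, HasDerivAt x (-(e * u t ^ 2)) t) → (∀ t, HasDerivAt u (e * x t * u t - e * u t * y t) t) →
    (∀ t, HasDerivAt y (e * u t ^ 2) t) → x 0 + y 0 = 1 → x 0 ^ 2 + u 0 ^ 2 + y 0 ^ 2 = 1 → 0 < u 0 →
    Tendsto y atTop (𝓝 1) ∧ Tendsto x atTop (𝓝 0) ∧ Tendsto u atTop (𝓝 0) := by
  intro e he x u y hx hu hy hL hE hu0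
  -- conservation of x + y
  have hLt : ∀ t, x t + y t = 1 := by
    have hd : Differentiable ℝ (x + y) := fun t => ((hx t).add (hy t)).differentiableAt
    have hd' : ∀ t, deriv (x + y) t = 0 := fun t => by
      rw [((hx t).add (hy t)).deriv]; ring
    intro t
    have h := is_const_of_deriv_eq_zero hd hd' t 0
    simp only [Pi.add_apply] at h
    linarith
  -- conservation of the energy
  have hEt : ∀ t, x t ^ 2 + u t ^ 2 + y t ^ 2 = 1 := by
    have hder : ∀ t, HasDerivAt (x ^ 2 + (u ^ 2 + y ^ 2))
        (↑(2 : ℕ) * x t ^ (2 - 1) * (-(e * u t ^ 2)) + (↑(2 : ℕ) * u t ^ (2 - 1) * (e * x t * u t - e * u t * y t) +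
          ↑(2 : ℕ) * y t ^ (2 - 1) * (e * u t ^ 2))) t := fun t =>
      ((hx t).pow 2).add (((hu t).pow 2).add ((hy t).pow 2))
    have hd : Differentiable ℝ (x ^ 2 + (u ^ 2 + y ^ 2)) := fun t => (hder t).differentiableAt
    have hd' : ∀ t, deriv (x ^ 2 + (u ^ 2 + y ^ 2)) t = 0 := fun t => by
      rw [(hder t).deriv]
      norm_num
      ring
    intro t
    have h := is_const_of_deriv_eq_zero hd hd' t 0
    simp only [Pi.add_apply, Pi.pow_apply] at h
    linarith
  -- logistic reduction
  have hx_eq : ∀ t, x t = 1 - y t := fun t => by linarith [hLt t]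
  have hu2 : ∀ t, u t ^ 2 = 2 * y t * (1 - y t) := fun t => by
    have h := hEt t
    rw [hx_eq t] at h
    nlinarith [h]
  have hprod : ∀ t, 0 ≤ y t * (1 - y t) := fun t => by nlinarith [hu2 t, sq_nonneg (u t)]
  have hy_le : ∀ t, y t ≤ 1 := fun t => by nlinarith [hprod t]
  have hy_ge : ∀ t, 0 ≤ y t := fun t => by nlinarith [hprod t]
  have hy0 : 0 < y 0 := by
    have h : 0 < y 0 * (1 - y 0) := by nlinarith [hu2 0, hu0]
    nlinarith [h, hy_le 0]
  -- monotonicity of y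
  have hdiff : Differentiable ℝ y := fun t => (hy t).differentiableAt
  have hderiv : ∀ t, deriv y t = 2 * e * (y t * (1 - y t)) := fun t => by
    rw [(hy t).deriv, hu2 t]; ring
  have hmono : Monotone y := monotone_of_deriv_nonneg hdiff (fun t => by
    rw [hderiv t]; exact mul_nonneg (by linarith) (hprod t))
  -- y exceeds every level below 1
  have hreach : ∀ ε : ℝ, 0 < ε → ∃ T : ℝ, 1 - ε < y T := by
    intro ε hε
    by_contra hcon
    push Not at hcon
    set m : ℝ := 2 * e * (y 0 * ε) with hm
    have hmpos : 0 < m := mul_pos (mul_pos two_pos he) (mul_pos hy0 hε)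
    have hbound : ∀ s ∈ interior (Set.Ici (0 : ℝ)), m ≤ deriv y s := by
      intro s hs
      rw [interior_Ici] at hs
      rw [hderiv s]
      have h1 : y 0 ≤ y s := hmono (le_of_lt hs)
      have h2 : ε ≤ 1 - y s := by linarith [hcon s]
      have h3 : y 0 * ε ≤ y s * (1 - y s) := mul_le_mul h1 h2 hε.le (hy_ge s)
      nlinarith [h3]
    have hmvt := (convex_Ici (0 : ℝ)).mul_sub_le_image_sub_of_le_deriv hdiff.continuous.continuousOn
      (hdiff.differentiableOn) hbound 0 (by simp) (1 / m) (by simpa using (div_pos one_pos hmpos).le) (div_pos one_pos hmpos).le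
    have h1m : m * (1 / m - 0) = 1 := by rw [sub_zero]; exact mul_one_div_cancel hmpos.ne'
    rw [h1m] at hmvt
    have := hcon (1 / m)
    linarith [hy_le (1 / m), hε]
  -- the limits
  have hY : Tendsto y atTop (𝓝 1) := by
    rw [tendsto_order]
    refine ⟨fun a ha => ?_, fun b hb => Eventually.of_forall fun t => lt_of_le_of_lt (hy_le t) hb⟩
    obtain ⟨T, hT⟩ := hreach (1 - a) (by linarith)
    exact eventually_atTop.2 ⟨T, fun t ht => by linarith [hmono ht]⟩
  have hX : Tendsto x atTop (𝓝 0) := by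
    have hfun : x = fun t => 1 - y t := funext hx_eq
    rw [hfun]
    simpa using (tendsto_const_nhds : Tendsto (fun _ : ℝ => (1 : ℝ)) atTop (𝓝 1)).sub hY
  have hU2 : Tendsto (fun t => u t ^ 2) atTop (𝓝 0) := by
    have hfun : (fun t => u t ^ 2) = fun t => 2 * y t * (1 - y t) := funext hu2
    rw [hfun]
    simpa using ((tendsto_const_nhds : Tendsto (fun _ : ℝ => (2 : ℝ)) atTop (𝓝 2)).mul hY).mul ((tendsto_const_nhds : Tendsto (fun _ : ℝ => (1 : ℝ)) atTop (𝓝 1)).sub hY)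
  have hU : Tendsto u atTop (𝓝 0) := by
    rw [tendsto_zero_iff_norm_tendsto_zero]
    have h := (Real.continuous_sqrt.tendsto 0).comp hU2
    rw [Real.sqrt_zero] at h
    refine h.congr fun t => ?_
    simp [Real.sqrt_sq_eq_abs, Real.norm_eq_abs]
  exact ⟨hY, hX, hU⟩


end Summit.NavierStokesRegularity.NavierStokesRegularity.Theorems
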